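import Literature.IUT.HodgeTheaters.SurfaceGroupLemma27
import Mathlib.LinearAlgebra.FreeModule.PID
import Mathlib.Algebra.Module.Torsion.Basic
import Mathlib.Algebra.EuclideanDomain.Int
import Mathlib.RingTheory.PrincipalIdealDomain
import Mathlib.GroupTheory.Schreier
import HarnessLib

/-!
# [IUTchI] Lemma 2.7 (iii) in the SPLIT form used by the proofs of Theorem 2.6 and Lemma 2.7 (vi)

Mochizuki, *Inter-universal Teichmüller Theory I*, kurims manuscript (May 2020), Lemma 2.7 (iii)
(statement p. 57) and its two applications: proof of Theorem 2.6, p. 57 l.14–17 ("after replacing `G`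
by an appropriate finite index subgroup of `G`, we may assume that there exist elements `x, y ∈ H_G`
that generate a free abelian subgroup of rank two `M ⊆ G^{ab}` such that the injection `M ↪ G^{ab}`
SPLITS") and proof of Lemma 2.7 (vi), p. 59 l.21–23 ("there exist a finite index subgroup `G₁ ⊆ G`
equipped with a surjection `β : G₁ ↠ ℤ × ℤ` and elements `x, y ∈ N ∩ G₁` such that `β(x) = (1,0)`
and `β(y) = (0,1)`") [cite: Mochizuki2012, IUTchI Lem 2.7 (iii) p.57] (D-0012 claim key; the series'
status is DISPUTED — the content here is plain combinatorial group theory / linear algebra over `ℤ`,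
no side taken).

The tree's named statement `FreeOrSurface.rankTwoInAbelianization` (abc-iut-L5-t1, typed "no nontrivial
relation between the images of `xⁿ`, `yⁿ` in `G₁^{ab}`") is a THEOREM (`…_holds`, abc-iut-L5-d1
p413769, free half abc-iut-L5-t10).  This proof-only file derives from it the SPLIT form print
actually uses: a finite index subgroup `G₂` containing `xⁿ, yⁿ` and a SURJECTIVE homomorphism
`β : G₂ ↠ ℤ × ℤ` with `β(xⁿ) = (1,0)`, `β(yⁿ) = (0,1)` (`FreeOrSurface.exists_finiteIndex_splitHom`).
Route: `G` is finitely generated (free of finite rank / surface presentation), so `G₁` is (Schreier,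
Mathlib `Subgroup.fg_of_index_ne_zero`) and `G₁^{ab}` is a finitely generated `ℤ`-module; modulo torsion
it is free (Mathlib, PID structure theory), the images `u, v` of `xⁿ, yⁿ` stay independent, some `2 × 2`
minor `d` of their coordinates is nonzero, and the two functionals
`f₁ = v_j e_i^* − v_i e_j^*`, `f₂ = u_i e_j^* − u_j e_i^*` satisfy `f₁(u) = f₂(v) = d`,
`f₁(v) = f₂(u) = 0`; on the finite index subgroup `G₂ = {g ∈ G₁ | d ∣ f₁(g), d ∣ f₂(g)}` the pair
`(f₁/d, f₂/d)` is the required `β`.  Intended consumer: the Stebe-free route to Lemma 2.7 (vi) for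
orientable surface groups (print p. 59), where `β` yields the continuous `Ĝ₂ ↠ ℤ̂ × ℤ̂`.
Theorems only; nothing here bears on [IUTchIII] Cor. 3.12.
-/

namespace Literature.IUT.HodgeTheaters

open Multiplicative

universe u

/-! ### Linear algebra: a pair of dual functionals for an independent pair in a free `ℤ`-module -/

/-- In a free `ℤ`-module, two `ℤ`-independent vectors `u, v` admit functionals `f₁, f₂` and a nonzero
integer `d` with `f₁ u = d`, `f₁ v = 0`, `f₂ u = 0`, `f₂ v = d` (a nonzero `2 × 2` minor of the
coordinate matrix). [cite: Mochizuki2012, IUTchI Lem 2.7 (iii) p.57] -/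
theorem exists_dual_pair_of_independent {R : Type*} [CommRing R] [Nontrivial R] {Q : Type*}
    [AddCommGroup Q] [Module R Q] [Module.Free R Q]
    (u v : Q) (hind : ∀ i j : R, i • u + j • v = 0 → i = 0 ∧ j = 0) :
    ∃ (f₁ f₂ : Q →ₗ[R] R) (d : R), d ≠ 0 ∧ f₁ u = d ∧ f₁ v = 0 ∧ f₂ u = 0 ∧ f₂ v = d := by
  classical
  let b := Module.Free.chooseBasis R Q
  -- `u ≠ 0`, so some coordinate of `u` is nonzero
  have hu0 : u ≠ 0 := by
    intro h
    have := (hind 1 0 (by simp [h])).1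
    exact one_ne_zero this
  obtain ⟨i₀, hi₀⟩ : ∃ i, b.repr u i ≠ 0 := by
    by_contra hall
    push Not at hall
    apply hu0
    exact b.ext_elem_iff.mpr fun i => by simp [hall i]
  -- some minor through the row `i₀` is nonzero
  obtain ⟨j₀, hj₀⟩ : ∃ j, b.repr u i₀ * b.repr v j - b.repr u j * b.repr v i₀ ≠ 0 := by
    by_contra hall
    push Not at hall
    -- then `(u_{i₀}) • v - (v_{i₀}) • u = 0`, a nontrivial relation
    have hrel : (-(b.repr v i₀)) • u + (b.repr u i₀) • v = 0 := by
      refine b.ext_elem_iff.mpr fun j => ?_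
      rw [map_add, map_smul, map_smul, map_zero, Finsupp.add_apply, Finsupp.smul_apply,
        Finsupp.smul_apply, Finsupp.zero_apply, smul_eq_mul, smul_eq_mul]
      have := hall j
      linear_combination this
    exact hi₀ (hind _ _ hrel).2
  set d := b.repr u i₀ * b.repr v j₀ - b.repr u j₀ * b.repr v i₀ with hd
  refine ⟨b.repr v j₀ • b.coord i₀ - b.repr v i₀ • b.coord j₀,
    b.repr u i₀ • b.coord j₀ - b.repr u j₀ • b.coord i₀, d, hj₀, ?_, ?_, ?_, ?_⟩ <;>
    simp only [LinearMap.sub_apply, LinearMap.smul_apply, Module.Basis.coord_apply, smul_eq_mul, hd] <;> ring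

/-! ### From independence in the abelianization to a homomorphism onto a rank-two lattice -/

/-- For a finitely generated group `H` and `a, b ∈ H` whose images in `H^{ab}` satisfy no nontrivial
relation, there are a homomorphism `Φ : H → ℤ × ℤ` and `d ≠ 0` with `Φ a = (d, 0)`, `Φ b = (0, d)`
(`H^{ab}` is a finitely generated `ℤ`-module; pass to its free quotient by torsion and apply
`exists_dual_pair_of_independent`). [cite: Mochizuki2012, IUTchI Lem 2.7 (iii) p.57] -/
theorem exists_hom_prod_int_of_independent {H : Type u} [Group H] [Group.FG H] (a b : H)
    (hind : ∀ i j : ℤ, Abelianization.of a ^ i * Abelianization.of b ^ j = 1 → i = 0 ∧ j = 0) :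
    ∃ (Φ : H →* Multiplicative ℤ × Multiplicative ℤ) (d : ℤ), d ≠ 0 ∧
      Φ a = (ofAdd d, 1) ∧ Φ b = (1, ofAdd d) := by
  classical
  -- the abelianization as a finitely generated `ℤ`-module
  let A := Abelianization H
  haveI : Group.FG A := Group.fg_of_surjective (QuotientGroup.mk'_surjective _)
  let M := Additive A
  haveI : Module.Finite ℤ M := Module.Finite.iff_addGroup_fg.mpr inferInstance
  let T : Submodule ℤ M := Submodule.torsion ℤ M
  haveI hQfin : Module.Finite ℤ (M ⧸ T) := Module.Finite.quotient ℤ T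
  haveI hQtf : Module.IsTorsionFree ℤ (M ⧸ T) := Submodule.QuotientTorsion.instIsTorsionFree
  haveI hQfree : Module.Free ℤ (M ⧸ T) := inferInstance
  let π : M →ₗ[ℤ] M ⧸ T := T.mkQ
  let u₀ : M := Additive.ofMul (Abelianization.of a)
  let v₀ : M := Additive.ofMul (Abelianization.of b)
  let u : M ⧸ T := π u₀
  let v : M ⧸ T := π v₀
  -- independence survives the passage to the torsion-free quotient
  have hind' : ∀ i j : ℤ, i • u + j • v = 0 → i = 0 ∧ j = 0 := by
    intro i j hij
    have hmem : i • u₀ + j • v₀ ∈ T := by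
      rw [← Submodule.Quotient.mk_eq_zero T]
      have : π (i • u₀ + j • v₀) = 0 := by rw [map_add, map_smul, map_smul]; exact hij
      exact this
    obtain ⟨c, hc⟩ := (Submodule.mem_torsion_iff _).mp hmem
    have hc0 : (c : ℤ) ≠ 0 := nonZeroDivisors.coe_ne_zero c
    have hrel : Abelianization.of a ^ ((c : ℤ) * i) * Abelianization.of b ^ ((c : ℤ) * j) = 1 := by
      have h1 : (c : ℤ) • (i • u₀ + j • v₀) = 0 := hc
      rw [smul_add, smul_smul, smul_smul] at h1
      have h2 := congrArg Additive.toMul h1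
      rw [toMul_add, toMul_zsmul, toMul_zsmul, toMul_zero] at h2
      exact h2
    obtain ⟨h1, h2⟩ := hind _ _ hrel
    exact ⟨(mul_eq_zero.mp h1).resolve_left hc0, (mul_eq_zero.mp h2).resolve_left hc0⟩
  obtain ⟨f₁, f₂, d, hd, h1u, h1v, h2u, h2v⟩ := exists_dual_pair_of_independent u v hind'
  -- back to multiplicative homomorphisms on `H`
  let ψ₁ : M →+ ℤ := f₁.toAddMonoidHom.comp π.toAddMonoidHom
  let ψ₂ : M →+ ℤ := f₂.toAddMonoidHom.comp π.toAddMonoidHom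
  let F₁ : A →* Multiplicative ℤ := AddMonoidHom.toMultiplicativeRight ψ₁
  let F₂ : A →* Multiplicative ℤ := AddMonoidHom.toMultiplicativeRight ψ₂
  refine ⟨(F₁.prod F₂).comp Abelianization.of, d, hd, ?_, ?_⟩
  · change (ofAdd (f₁ u), ofAdd (f₂ u)) = _
    rw [h1u, h2u]; rfl
  · change (ofAdd (f₁ v), ofAdd (f₂ v)) = _
    rw [h1v, h2v]; rfl

/-! ### Rescaling on a finite index subgroup -/

/-- From `Φ : H → ℤ × ℤ` with `Φ a = (d, 0)`, `Φ b = (0, d)`, `d ≠ 0`: on the finite index subgroup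
`K = Φ⁻¹(dℤ × dℤ)` (the kernel of `Φ mod d`), which contains `a` and `b`, the rescaled map
`β = Φ / d : K ↠ ℤ × ℤ` is a surjective homomorphism with `β a = (1,0)`, `β b = (0,1)` — print's
"replacing `G` by an appropriate finite index subgroup … the injection `M ↪ G^{ab}` splits".
[cite: Mochizuki2012, IUTchI Thm 2.6 p.57] -/
theorem exists_finiteIndex_splitHom_of_hom {H : Type u} [Group H] (a b : H)
    (Φ : H →* Multiplicative ℤ × Multiplicative ℤ) (d : ℤ) (hd : d ≠ 0)
    (ha : Φ a = (ofAdd d, 1)) (hb : Φ b = (1, ofAdd d)) :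
    ∃ (K : Subgroup H) (haK : a ∈ K) (hbK : b ∈ K) (β : K →* Multiplicative ℤ × Multiplicative ℤ),
      K.FiniteIndex ∧ Function.Surjective β ∧ β ⟨a, haK⟩ = (ofAdd 1, 1) ∧ β ⟨b, hbK⟩ = (1, ofAdd 1) := by
  classical
  set n : ℕ := d.natAbs with hn
  haveI : NeZero n := ⟨Int.natAbs_ne_zero.mpr hd⟩
  -- reduction mod `n = |d|`
  let r : Multiplicative ℤ →* Multiplicative (ZMod n) :=
    AddMonoidHom.toMultiplicative (Int.castAddHom (ZMod n))
  let χ : H →* Multiplicative (ZMod n) × Multiplicative (ZMod n) := (r.prodMap r).comp Φ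
  let K : Subgroup H := χ.ker
  haveI : Finite χ.range := inferInstance
  have hKfi : K.FiniteIndex := inferInstance
  -- `d ∣ m ↔ (m : ZMod n) = 0`
  have hdvd : ∀ m : ℤ, r (ofAdd m) = 1 ↔ d ∣ m := by
    intro m
    change ofAdd ((m : ZMod n)) = 1 ↔ _
    rw [ofAdd_eq_one, ZMod.intCast_zmod_eq_zero_iff_dvd, hn, Int.natAbs_dvd]
  have hmemK : ∀ h : H, h ∈ K ↔ d ∣ toAdd (Φ h).1 ∧ d ∣ toAdd (Φ h).2 := by
    intro h
    rw [MonoidHom.mem_ker]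
    change (r (Φ h).1, r (Φ h).2) = (1, 1) ↔ _
    rw [Prod.mk.injEq, ← hdvd, ← hdvd, ofAdd_toAdd, ofAdd_toAdd]
  have haK : a ∈ K := by
    rw [hmemK, ha]
    exact ⟨by simp, by simp⟩
  have hbK : b ∈ K := by
    rw [hmemK, hb]
    exact ⟨by simp, by simp⟩
  -- the rescaled coordinates
  let e₁ : K → ℤ := fun k => toAdd (Φ k.1).1 / d
  let e₂ : K → ℤ := fun k => toAdd (Φ k.1).2 / d
  have he₁ : ∀ k l : K, e₁ (k * l) = e₁ k + e₁ l := by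
    intro k l
    simp only [e₁, Subgroup.coe_mul, map_mul, Prod.fst_mul, toAdd_mul]
    exact Int.add_ediv_of_dvd_left (((hmemK k.1).mp k.2).1)
  have he₂ : ∀ k l : K, e₂ (k * l) = e₂ k + e₂ l := by
    intro k l
    simp only [e₂, Subgroup.coe_mul, map_mul, Prod.snd_mul, toAdd_mul]
    exact Int.add_ediv_of_dvd_left (((hmemK k.1).mp k.2).2)
  let β : K →* Multiplicative ℤ × Multiplicative ℤ :=
    { toFun := fun k => (ofAdd (e₁ k), ofAdd (e₂ k))
      map_one' := by
        simp only [e₁, e₂, OneMemClass.coe_one, map_one, Prod.fst_one, Prod.snd_one, toAdd_one,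
          Int.zero_ediv, ofAdd_zero, Prod.mk_eq_one, and_self]
      map_mul' := fun k l => by
        change (ofAdd (e₁ (k * l)), ofAdd (e₂ (k * l))) =
          (ofAdd (e₁ k), ofAdd (e₂ k)) * (ofAdd (e₁ l), ofAdd (e₂ l))
        rw [Prod.mk_mul_mk, ← ofAdd_add, ← ofAdd_add, ← he₁, ← he₂] }
  have hβa : β ⟨a, haK⟩ = (ofAdd 1, 1) := by
    change (ofAdd (toAdd (Φ a).1 / d), ofAdd (toAdd (Φ a).2 / d)) = _
    rw [ha]
    simp [Int.ediv_self hd]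
  have hβb : β ⟨b, hbK⟩ = (1, ofAdd 1) := by
    change (ofAdd (toAdd (Φ b).1 / d), ofAdd (toAdd (Φ b).2 / d)) = _
    rw [hb]
    simp [Int.ediv_self hd]
  refine ⟨K, haK, hbK, β, hKfi, ?_, hβa, hβb⟩
  -- surjectivity: `β (a^p b^q) = (p, q)`
  rintro ⟨p, q⟩
  refine ⟨⟨a, haK⟩ ^ (toAdd p) * ⟨b, hbK⟩ ^ (toAdd q), ?_⟩
  rw [map_mul, map_zpow, map_zpow, hβa, hβb, Prod.pow_mk, Prod.pow_mk, one_zpow, one_zpow,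
    Prod.mk_mul_mk, one_mul, mul_one, ← ofAdd_zsmul, ← ofAdd_zsmul, smul_eq_mul, smul_eq_mul,
    mul_one, mul_one, ofAdd_toAdd, ofAdd_toAdd]

/-! ### Lemma 2.7 (iii), split form -/

/-- Groups "as in Theorem 2.6" are finitely generated (a free group of finite rank; a surface group,
being finitely presented). [cite: Mochizuki2012, IUTchI Thm 2.6 p.56] -/
theorem IsFreeOrSurface.fg {G : Type u} [Group G] (hG : IsFreeOrSurface G) : Group.FG G := by
  rcases hG with ⟨n, ⟨e⟩⟩ | ⟨g, -, ⟨e⟩⟩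
  · exact Group.fg_of_surjective (f := e.symm.toMonoidHom) e.symm.surjective
  · haveI : Group.FG (SurfaceGroup g) :=
      Group.fg_of_surjective (f := PresentedGroup.mk _) (PresentedGroup.mk_surjective _)
    exact Group.fg_of_surjective (f := e.symm.toMonoidHom) e.symm.surjective

/-- **[IUTchI] Lemma 2.7 (iii), in the split form used on p. 57 l.14–17 and p. 59 l.21–23**: for `G`
free of finite rank or an orientable surface group and non-commuting `x, y ∈ G`, there are a finite
index subgroup `G₂ ⊆ G`, a positive integer `n` with `xⁿ, yⁿ ∈ G₂`, and a SURJECTIVE homomorphism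
`β : G₂ ↠ ℤ × ℤ` with `β(xⁿ) = (1, 0)` and `β(yⁿ) = (0, 1)` (so the images of `xⁿ, yⁿ` generate a
rank-two free abelian DIRECT SUMMAND of `G₂^{ab}`).  From the typed Lemma 2.7 (iii)
(`FreeOrSurface.rankTwoInAbelianization_holds`) by `exists_hom_prod_int_of_independent` and
`exists_finiteIndex_splitHom_of_hom`. [cite: Mochizuki2012, IUTchI Lem 2.7 (iii) p.57] -/
theorem FreeOrSurface.exists_finiteIndex_splitHom (G : Type u) [Group G] (hG : IsFreeOrSurface G)
    (x y : G) (hxy : x * y ≠ y * x) :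
    ∃ (G₂ : Subgroup G) (n : ℕ) (hx : x ^ n ∈ G₂) (hy : y ^ n ∈ G₂)
      (β : G₂ →* Multiplicative ℤ × Multiplicative ℤ),
      G₂.FiniteIndex ∧ 0 < n ∧ Function.Surjective β ∧
        β ⟨x ^ n, hx⟩ = (ofAdd 1, 1) ∧ β ⟨y ^ n, hy⟩ = (1, ofAdd 1) := by
  classical
  haveI : Group.FG G := hG.fg
  obtain ⟨G₁, n, hx, hy, hfi, hn, hind⟩ := FreeOrSurface.rankTwoInAbelianization_holds G hG x y hxy
  haveI : G₁.FiniteIndex := hfi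
  obtain ⟨Φ, d, hd, ha, hb⟩ :=
    exists_hom_prod_int_of_independent (H := G₁) ⟨x ^ n, hx⟩ ⟨y ^ n, hy⟩ hind
  obtain ⟨K, haK, hbK, β, hKfi, hβs, hβa, hβb⟩ :=
    exists_finiteIndex_splitHom_of_hom (H := G₁) ⟨x ^ n, hx⟩ ⟨y ^ n, hy⟩ Φ d hd ha hb
  haveI : K.FiniteIndex := hKfi
  -- transport `K ⊆ G₁` to a subgroup of `G`
  let G₂ : Subgroup G := K.map G₁.subtype
  have hinj : Function.Injective G₁.subtype := Subtype.coe_injective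
  let e : K ≃* G₂ := K.equivMapOfInjective G₁.subtype hinj
  have hx₂ : x ^ n ∈ G₂ := ⟨⟨x ^ n, hx⟩, haK, rfl⟩
  have hy₂ : y ^ n ∈ G₂ := ⟨⟨y ^ n, hy⟩, hbK, rfl⟩
  have hex : e ⟨⟨x ^ n, hx⟩, haK⟩ = ⟨x ^ n, hx₂⟩ :=
    Subtype.ext (Subgroup.coe_equivMapOfInjective_apply K G₁.subtype hinj _)
  have hey : e ⟨⟨y ^ n, hy⟩, hbK⟩ = ⟨y ^ n, hy₂⟩ :=
    Subtype.ext (Subgroup.coe_equivMapOfInjective_apply K G₁.subtype hinj _)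
  refine ⟨G₂, n, hx₂, hy₂, β.comp e.symm.toMonoidHom, ?_, hn, ?_, ?_, ?_⟩
  · constructor
    rw [Subgroup.index_map_subtype]
    exact Nat.mul_ne_zero hKfi.index_ne_zero hfi.index_ne_zero
  · exact hβs.comp e.symm.surjective
  · rw [MonoidHom.comp_apply, MulEquiv.coe_toMonoidHom, ← hex, MulEquiv.symm_apply_apply, hβa]
  · rw [MonoidHom.comp_apply, MulEquiv.coe_toMonoidHom, ← hey, MulEquiv.symm_apply_apply, hβb]

end Literature.IUT.HodgeTheaters
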